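import Summits.HubbardSuperconductivity.HubbardSuperconductivity.Theorems.NodalWardXYNodalReductionDefs
import Literature.MathematicalPhysics.QuantumLattice.PairFieldMomentum
import Literature.MathematicalPhysics.QuantumLattice.HubbardModelGrandCanonicalProofs

/-!
# The Koma–Tasaki bridge, assembled: crux `NodalReduction` (stmt-HubbardSuperconductivity-1268), line `Sketch`, stub `stub_ktBridge_of`

Statement (F) of the skeleton of the line `Sketch`: the Koma–Tasaki / Kaplan–Horsch–von der Linden bridge
`KTBridge` of `NodalWardXYNodalReductionDefs` ("a zero-field plateau `a (L+1)⁴ ≤ Re ω₀^{L+1}(Δᴴ Δ)` of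
`d_{x²-y²}` pair long-range order in the tracial grand-canonical ground state forces
`√(a/2) ≤ dWaveOrderParameter U μ`") follows from the five statements (A) `TrialStateBound`,
(B) `DoubleCommutatorForm`, (C) `OrderSqLower`, (D) `SelectionRules`, (E) `GoodGroundVector` of the same
file. This file is the bookkeeping: no physics and no new definitions.

Content.

* `ktb_gain` — the abstract energy-gain inequality (finite-dimensional linear algebra, for commuting
  Hermitian `K, N` and any `Δ`, `O = Δ + Δᴴ`): if the selection rules (D) hold for `N`-eigenvectors, the
  double-commutator form `Re⟨Φ,[[O,K],O]Φ⟩` is `≤ B ≤ B'` on unit vectors, `‖OΦ‖² ≥ 2 Re⟨Φ,ΔᴴΔΦ⟩ - C`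
  (`C ≤ C'`) on unit vectors obeying the two charge identities, and `t ≤ Re ω_K(ΔᴴΔ)` with `2t - C' > 0`,
  then `E₀(K) - E₀(K - hO) ≥ h √(2t - C') - B'/(4(2t - C'))` for `h ≥ 0`: (E) picks a joint unit
  eigenvector `Φ` carrying the plateau, (D) kills `⟨Φ,OΦ⟩, ⟨Φ,Δ²Φ⟩, ⟨Φ,Δᴴ²Φ⟩, ⟨Φ,O³Φ⟩`, (C) gives
  `s = ‖OΦ‖² ≥ 2t - C' > 0`, (A) gives `E₀(K - hO) ≤ E₀(K) + D/(4s) - h√s` with `D ≤ B'` by (B), and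
  `√`, `x ↦ 1/x` are monotone.
* `ktb_arith` — the elementary real inequality turning the gain at `t = a y⁴`, `C' = C₁ y²`, `B' = C₂ y²`
  (`y = L + 1`, `C₁ ≤ a y²`) into `gain/(2hy²) ≥ √(a/2) - M/y²`, `M = (4hC₁√(a/2) + C₂)/(8ha)`
  (uses `√s ≥ √(a/2)(2y² - C₁/a)` by squaring, and `s ≥ a y²`).
* `ktb_le_liminf_of_tendsto` — `g → c`, `g ≤ r` eventually, `r` eventually bounded above
  `⇒ c ≤ liminf r` (Mathlib's `liminf_le_liminf`).
* `stub_ktBridge_of` — the assembly through the tree lever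
  `le_dWaveOrderParameter_of_le_liminf_energyGain` (`DWaveOrderParameterProofs`): for every
  `h ∈ (0,1)` the normalised gain `(E_{L+1}(0) - E_{L+1}(h))/(2h(L+1)²)` is eventually
  `≥ √(a/2) - M/(L+1)²` and always `≤ B_d` (`energyGain_div_le_dWaveSourceDensity`,
  `dWaveSourceDensity_le_const`).

Sources: T. Koma, H. Tasaki, Commun. Math. Phys. 158 (1993) 191, Theorems 7.1/7.3; T. Koma, H. Tasaki,
J. Stat. Phys. 76 (1994) 745, Theorem 2.2 and its proof ((2.9), (2.18)); T. A. Kaplan, P. Horsch,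
W. von der Linden, J. Phys. Soc. Jpn. 58 (1989) 3894. Design: the five inputs are hypotheses (they land as
the sibling stubs of the line); the matrix step is stated for an arbitrary finite index type so that the
torus instantiation (`K = hubbardTorusWith 2 (L+1) 1 U μ`, `N = totalNumber`,
`Δ = pairField dWaveFormFactor (L+1)`, `[K,N] = 0` by `hamiltonianWith_commute_totalNumber`) is a one-liner.
-/

noncomputable section

-- `Summit.HubbardSuperconductivity.HubbardSuperconductivity.…` is the tree's summit/sub-problem namespace (D-0017).
set_option linter.dupNamespace false

namespace Summit.HubbardSuperconductivity.HubbardSuperconductivity.Theorems.NodalReduction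

open Filter Matrix
open Literature.MathematicalPhysics.QuantumLattice Literature.Probability.LatticeModels
open scoped Matrix.Norms.L2Operator ComplexOrder Topology

/-! ### The abstract energy gain -/

/-- **Abstract Koma–Tasaki energy gain.** For commuting Hermitian `K, N`, any `Δ` with `O = Δ + Δᴴ`, and
`h ≥ 0`: the selection rules for `N`-eigenvectors, a bound `B ≤ B'` (`0 ≤ B'`) on the double-commutator
form `Re⟨Φ,[[O,K],O]Φ⟩` over unit vectors, the lower bound `2 Re⟨Φ,ΔᴴΔΦ⟩ - C ≤ ‖OΦ‖²` (`C ≤ C'`) over unit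
vectors with `⟨Φ,Δ²Φ⟩ = 0 = ⟨Φ,Δᴴ²Φ⟩`, and a plateau `t ≤ Re ω_K(ΔᴴΔ)` with `0 < 2t - C'` give
`h √(2t - C') - B'/(4(2t - C')) ≤ E₀(K) - E₀(K - hO)` (Koma–Tasaki 1994, proof of Thm 2.2). -/
theorem ktb_gain (hA : TrialStateBound) (hE : GoodGroundVector) {n : Type} [Fintype n] [DecidableEq n]
    [Nonempty n] {K N Δ : Matrix n n ℂ} (hK : K.IsHermitian) (hN : N.IsHermitian) (hKN : K * N = N * K)
    {t C C' B B' h : ℝ} (hCC' : C ≤ C') (hBB' : B ≤ B') (hB' : 0 ≤ B') (hh : 0 ≤ h)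
    (hpos : 0 < 2 * t - C')
    (hsel : ∀ (Φ : n → ℂ) (c : ℂ), N *ᵥ Φ = c • Φ →
      star Φ ⬝ᵥ ((Δ + Δᴴ) *ᵥ Φ) = 0 ∧ star Φ ⬝ᵥ ((Δ * Δ) *ᵥ Φ) = 0 ∧
        star Φ ⬝ᵥ ((Δᴴ * Δᴴ) *ᵥ Φ) = 0 ∧ star Φ ⬝ᵥ (((Δ + Δᴴ) * (Δ + Δᴴ) * (Δ + Δᴴ)) *ᵥ Φ) = 0)
    (hdc : ∀ Φ : n → ℂ, star Φ ⬝ᵥ Φ = 1 →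
      (star Φ ⬝ᵥ ((((Δ + Δᴴ) * K - K * (Δ + Δᴴ)) * (Δ + Δᴴ) -
        (Δ + Δᴴ) * ((Δ + Δᴴ) * K - K * (Δ + Δᴴ))) *ᵥ Φ)).re ≤ B)
    (hsq : ∀ Φ : n → ℂ, star Φ ⬝ᵥ Φ = 1 → star Φ ⬝ᵥ ((Δ * Δ) *ᵥ Φ) = 0 →
      star Φ ⬝ᵥ ((Δᴴ * Δᴴ) *ᵥ Φ) = 0 →
      2 * (star Φ ⬝ᵥ ((Δᴴ * Δ) *ᵥ Φ)).re - C ≤ (star ((Δ + Δᴴ) *ᵥ Φ) ⬝ᵥ ((Δ + Δᴴ) *ᵥ Φ)).re)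
    (hplat : t ≤ (K.groundStateFunctional (Δᴴ * Δ)).re) :
    h * Real.sqrt (2 * t - C') - B' / (4 * (2 * t - C')) ≤
      K.groundEnergy - (K - (h : ℂ) • (Δ + Δᴴ)).groundEnergy := by
  -- (E): a joint unit eigenvector carrying the plateau
  obtain ⟨Φ, c, hΦ1, hKΦ, hNΦ, htΦ⟩ :=
    hE K N (Δᴴ * Δ) hK hN hKN (posSemidef_conjTranspose_mul_self Δ) t hplat
  -- (D): selection rules
  obtain ⟨hO1, hΔ2, hΔ2', hO3⟩ := hsel Φ c hNΦ
  -- (C): `s = ‖OΦ‖² ≥ 2t - C' > 0`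
  have hs : 2 * t - C' ≤ (star ((Δ + Δᴴ) *ᵥ Φ) ⬝ᵥ ((Δ + Δᴴ) *ᵥ Φ)).re := by
    have := hsq Φ hΦ1 hΔ2 hΔ2'
    linarith
  have hspos : 0 < (star ((Δ + Δᴴ) *ᵥ Φ) ⬝ᵥ ((Δ + Δᴴ) *ᵥ Φ)).re := hpos.trans_le hs
  -- (B): the double commutator form
  have hD := (hdc Φ hΦ1).trans hBB'
  -- (A): the trial-state inequality
  have hAin := hA K (Δ + Δᴴ) hK (isHermitian_add_transpose_self Δ) Φ hΦ1 hKΦ hO1 hO3 hspos h hh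
  -- monotonicity
  have h1 : h * Real.sqrt (2 * t - C') ≤
      h * Real.sqrt ((star ((Δ + Δᴴ) *ᵥ Φ) ⬝ᵥ ((Δ + Δᴴ) *ᵥ Φ)).re) :=
    mul_le_mul_of_nonneg_left (Real.sqrt_le_sqrt hs) hh
  have h2 : (star Φ ⬝ᵥ ((((Δ + Δᴴ) * K - K * (Δ + Δᴴ)) * (Δ + Δᴴ) -
        (Δ + Δᴴ) * ((Δ + Δᴴ) * K - K * (Δ + Δᴴ))) *ᵥ Φ)).re /
        (4 * (star ((Δ + Δᴴ) *ᵥ Φ) ⬝ᵥ ((Δ + Δᴴ) *ᵥ Φ)).re) ≤ B' / (4 * (2 * t - C')) :=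
    (div_le_div_of_nonneg_right hD (by positivity)).trans
      (div_le_div_of_nonneg_left hB' (by positivity) (by linarith))
  linarith

/-! ### Elementary real analysis -/

/-- The arithmetic of the Koma–Tasaki bound at volume `y² = (L+1)²`: from
`h √(2ay⁴ - C₁y²) - C₂y²/(4(2ay⁴ - C₁y²)) ≤ gain` with `0 ≤ C₁ ≤ a y²`, `0 ≤ C₂`, `1 ≤ y`, `0 < h` and
`ℓ² = a/2` (i.e. `ℓ = ±√(a/2)`) one gets `ℓ - M/y² ≤ gain/(2hy²)` with the `y`-independent `M = (4hC₁ℓ + C₂)/(8ha)`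
(squaring `ℓ(2y² - C₁/a) ≤ √(2ay⁴ - C₁y²)` and `a y² ≤ 2ay⁴ - C₁y²`). -/
theorem ktb_arith {a C₁ C₂ h y ℓ gain : ℝ} (ha : 0 < a) (hℓ2 : ℓ ^ 2 = a / 2)
    (hC₁ : 0 ≤ C₁) (hC₂ : 0 ≤ C₂) (hh : 0 < h) (hy : 1 ≤ y) (hCy : C₁ ≤ a * y ^ 2)
    (hgain : h * Real.sqrt (2 * (a * y ^ 4) - C₁ * y ^ 2) -
        C₂ * y ^ 2 / (4 * (2 * (a * y ^ 4) - C₁ * y ^ 2)) ≤ gain) :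
    ℓ - (4 * h * C₁ * ℓ + C₂) / (8 * h * a) / y ^ 2 ≤ gain / (2 * h * y ^ 2) := by
  obtain ⟨k, hk, rfl⟩ : ∃ k, 0 ≤ k ∧ C₁ = a * k :=
    ⟨C₁ / a, div_nonneg hC₁ ha.le, by rw [← mul_div_assoc, mul_div_cancel_left₀ _ ha.ne']⟩
  have hky : k ≤ y ^ 2 := le_of_mul_le_mul_left hCy ha
  have hy2 : 1 ≤ y ^ 2 := one_le_pow₀ hy
  have hy0 : y ≠ 0 := by positivity
  have hh0 : h ≠ 0 := hh.ne'
  have ha0 : a ≠ 0 := ha.ne'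
  set s₀ := 2 * (a * y ^ 4) - a * k * y ^ 2 with hs₀
  have hs₁ : a * y ^ 2 * y ^ 2 ≤ s₀ := by
    rw [hs₀]
    nlinarith [mul_nonneg (mul_nonneg ha.le (sq_nonneg y)) (sub_nonneg.2 hky)]
  have hs₂ : a * y ^ 2 ≤ s₀ := by
    nlinarith [mul_le_mul_of_nonneg_left hy2 (mul_nonneg ha.le (sq_nonneg y))]
  have hs₃ : 0 < s₀ := lt_of_lt_of_le (by positivity) hs₂
  have h1 : ℓ * (2 * y ^ 2 - k) ≤ Real.sqrt s₀ := by
    refine Real.le_sqrt_of_sq_le ?_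
    rw [mul_pow, hℓ2, hs₀]
    nlinarith [mul_nonneg (mul_nonneg ha.le hk) (by linarith : (0 : ℝ) ≤ 2 * y ^ 2 - k)]
  have h2 : C₂ * y ^ 2 / (4 * s₀) ≤ C₂ / (4 * a) := by
    rw [div_le_div_iff₀ (by positivity) (by positivity)]
    nlinarith [mul_le_mul_of_nonneg_left hs₂ hC₂]
  have key : (ℓ - (4 * h * (a * k) * ℓ + C₂) / (8 * h * a) / y ^ 2) * (2 * h * y ^ 2) =
      h * (ℓ * (2 * y ^ 2 - k)) - C₂ / (4 * a) := by
    field_simp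
    ring
  rw [le_div_iff₀ (by positivity), key]
  linarith [mul_le_mul_of_nonneg_left h1 hh.le]

/-- A sequence eventually above a convergent minorant and eventually bounded above has `liminf` at least
the limit of the minorant. -/
theorem ktb_le_liminf_of_tendsto {r g : ℕ → ℝ} {c B : ℝ} (hg : Tendsto g atTop (𝓝 c))
    (hle : ∀ᶠ L in atTop, g L ≤ r L) (hbdd : ∀ᶠ L in atTop, r L ≤ B) : c ≤ liminf r atTop := by
  rw [← hg.liminf_eq]
  exact liminf_le_liminf hle hg.isBoundedUnder_ge (isCoboundedUnder_ge_of_eventually_le atTop hbdd)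

/-! ### The bridge -/

/-- **(F) Assembly of the Koma–Tasaki / Kaplan–Horsch–von der Linden bridge** for the grand-canonical
Hubbard torus: (A) `TrialStateBound`, (B) `DoubleCommutatorForm`, (C) `OrderSqLower`, (D) `SelectionRules`
and (E) `GoodGroundVector` imply `KTBridge` — a zero-field plateau `a (L+1)⁴ ≤ Re ω₀^{L+1}(ΔᴴΔ)`
eventually in `L` forces `√(a/2) ≤ dWaveOrderParameter U μ`. By the tree lever
`le_dWaveOrderParameter_of_le_liminf_energyGain` it suffices to bound, for `h ∈ (0,1)`, the `liminf` of
the normalised energy gain `(E_{L+1}(0) - E_{L+1}(h))/(2h(L+1)²)`; `ktb_gain` at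
`K = hubbardTorusWith 2 (L+1) 1 U μ`, `N = totalNumber`, `Δ = pairField dWaveFormFactor (L+1)` and
`ktb_arith` bound it below by `√(a/2) - M/(L+1)² → √(a/2)` eventually (Koma–Tasaki, CMP 158 (1993),
Thm 7.1/7.3; J. Stat. Phys. 76 (1994), Thm 2.2). -/
theorem stub_ktBridge_of : TrialStateBound → DoubleCommutatorForm → OrderSqLower → SelectionRules →
    GoodGroundVector → KTBridge := by
  intro hA hB hC hD hE U μ a ha hplat
  obtain ⟨C₂, hC₂⟩ := hB U μ
  obtain ⟨C₁, hC₁⟩ := hC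
  refine le_dWaveOrderParameter_of_le_liminf_energyGain U μ zero_lt_one fun h hh => ?_
  set ℓ := Real.sqrt (a / 2)
  have hℓ2 : ℓ ^ 2 = a / 2 := Real.sq_sqrt (by positivity)
  have hx : Tendsto (fun L : ℕ => (((L + 1 : ℕ) : ℝ)) ^ 2) atTop atTop :=
    (tendsto_pow_atTop two_ne_zero).comp (tendsto_natCast_atTop_atTop.comp (tendsto_add_atTop_nat 1))
  -- the eventual lower bound
  have hev : ∀ᶠ L : ℕ in atTop,
      ℓ - (4 * h * max C₁ 0 * ℓ + max C₂ 0) / (8 * h * a) / (((L + 1 : ℕ) : ℝ)) ^ 2 ≤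
        ((dWaveSourceTorus (L + 1) U μ 0).groundEnergy -
            (dWaveSourceTorus (L + 1) U μ h).groundEnergy) / (2 * h * (((L + 1 : ℕ) : ℝ)) ^ 2) := by
    filter_upwards [hplat, hx.eventually_ge_atTop (max C₁ 0 / a)] with L hpl hCL
    rw [dWaveSourceTorus_zero, dWaveSourceTorus_eq]
    set y : ℝ := ((L + 1 : ℕ) : ℝ) with hydef
    have hy1 : (1 : ℝ) ≤ y := by
      rw [hydef]
      exact_mod_cast Nat.le_add_left 1 L
    have hCy : max C₁ 0 ≤ a * y ^ 2 := by
      rw [mul_comm]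
      exact (div_le_iff₀ ha).1 hCL
    have hy4 : 0 < a * y ^ 4 := by positivity
    have hpos : 0 < 2 * (a * y ^ 4) - max C₁ 0 * y ^ 2 := by
      nlinarith [mul_le_mul_of_nonneg_right hCy (sq_nonneg y)]
    exact ktb_arith ha hℓ2 (le_max_right C₁ 0) (le_max_right C₂ 0) hh.1 hy1 hCy
      (ktb_gain hA hE (isHermitian_hubbardTorusWith (L + 1) 1 U μ) totalNumber_isHermitian
        (hamiltonianWith_commute_totalNumber (fermionTorusGraph 2 (L + 1)) 1 U μ).eq
        (mul_le_mul_of_nonneg_right (le_max_left C₁ 0) (sq_nonneg y))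
        (mul_le_mul_of_nonneg_right (le_max_left C₂ 0) (sq_nonneg y)) (by positivity) hh.1.le hpos
        (fun Φ c hΦ => hD (L + 1) Φ c hΦ) (fun Φ hΦ => hC₂ (L + 1) Φ hΦ)
        (fun Φ hΦ h1 h2 => hC₁ (L + 1) Φ hΦ h1 h2) hpl)
  -- the a priori upper bound (coboundedness)
  have hbdd : ∀ᶠ L : ℕ in atTop,
      ((dWaveSourceTorus (L + 1) U μ 0).groundEnergy -
          (dWaveSourceTorus (L + 1) U μ h).groundEnergy) / (2 * h * (((L + 1 : ℕ) : ℝ)) ^ 2) ≤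
        2 * ∑ e ∈ insert (0 : Site 2) unitSteps, |dWaveFormFactor e / Real.sqrt 2| :=
    Eventually.of_forall fun L =>
      (energyGain_div_le_dWaveSourceDensity U μ hh.1).trans (dWaveSourceDensity_le_const _ U μ h)
  -- the limit of the minorant
  have hM : Tendsto (fun L : ℕ => (4 * h * max C₁ 0 * ℓ + max C₂ 0) / (8 * h * a) /
      (((L + 1 : ℕ) : ℝ)) ^ 2) atTop (𝓝 0) := tendsto_const_nhds.div_atTop hx
  have hg := hM.const_sub ℓ
  rw [sub_zero] at hg
  exact ktb_le_liminf_of_tendsto hg hev hbdd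

end Summit.HubbardSuperconductivity.HubbardSuperconductivity.Theorems.NodalReduction

end
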